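import Literature.AnabelianGeometry.EtaleTheta.Discharge.Sec5Thm57AnchoredFamilyConstAnchor
import Literature.AnabelianGeometry.EtaleTheta.Discharge.Sec5Thm57TorsionOfKummerCocycle

/-!
# [EtTh] §5, Theorem 5.7 at ALL levels from a CONSTANT-ANCHORED family, (C)-column in TORSION shape: the anabelian residual `hc`
# of the constant-anchored capstone replaced by the torsion of the Kummer cocycles of the family's discrepancies
# (pp. 296, 318–319, 329–331 / PDF pp. 70, 92–93, 103–105)

Mochizuki, *The étale theta function …*, Publ. RIMS **45** (2009)
[cite: MochizukiEtTh2009, Thm 5.7 p.330 (PDF p.104); Rmk 4.3.2 p.318–319 (PDF pp.92–93); Lem 5.8 p.331 (PDF p.105);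
Prop 3.2 (iii) p.296 (PDF p.70)].  abc-iut cell, layer L2, node `EtTh:Thm5.7`; abc-iut-L2-lead (gen 6) R732 «(C) COMPOSER» — ROOT-SIDE half
(seat abc-iut-f-123 gen 6, second in the composer order).  PROOF-ONLY twin (0 definitions, 0 new named facts; nothing landed is edited or
restated) of this seat's `…_ofConstAnchored_ofPulledConstants` (`Sec5Thm57AnchoredFamilyConstAnchor.lean`, p472561) in which abc-iut-L2-d4's
generic closer `thetaRootPreservedAll_of_anchoredFamily` is replaced by abc-iut-w6-d049's `thetaRootPreservedAll_of_anchoredFamily_of_kummerTorsion`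
(`Sec5Thm57TorsionOfKummerCocycle.lean`, p473372): the anabelian residual (C) `hc` («the level-1 discrepancy constant of every normalised
transport is a `2l`-th root of unity») is REPLACED by its torsion-shape inputs —
* `hK` : `⋂_N (K^×)^N = 1` on the constants `K'` (Prop. 3.2 (iii));
* `hgc` : Lemma 5.8's geometric connectedness at EVERY level `N` («a unit of `B_N` commuting with `s^⊓-gp_N(Im Π^tp_Y̲)` is a constant»;
  the level-1 instance is the binder `hgc₁` of p442166, there discharged from the ONE junction binder `ConstantsDictionary`);
* a cofinal set `S` of levels (`hS`) with Prop. 4.3 (iii) `hdiff` and the factorisation `hfacS` at its levels;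
* `htorsfam` : for the CONSTANT normalised anchor, every level `N ∈ S` and every family member `(a, b, w)` coherent with the anchor
  (its four transport/coherence equations), the Kummer cocycle of `w^{2l}` along `H_{B_N}` is that of a torsion unit `u ∈ μ_N(B_N)` —
  w6-d049's `htors` VERBATIM, quantified over the family the composer chooses (the (C) lane instantiates it from the étale clause
  «`κ_N^{2l}` is a coboundary» + `CyclotomicCharacterCompat`, `kummerTorsion_of_etaleTorsion`).
RESULT `thetaRootPreservedAll_ofConnectedTemperoidYddFamily_ofConstAnchored_ofKummerTorsion` (genuine connected tower, pulled-back constants;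
every other binder as in p472561 §2).
HONEST FRAMING: kernel-checked implication under named hypotheses for data so parametrised (the class `TemperedFrobenioid T₀ (ConnectedPart
(BTemp X.Pi)) VD` is not shown inhabited for an actual curve); nothing asserts any result of [EtTh] unconditionally; typed ≠ discharged; no side
taken on anything downstream ([IUTchIII] Cor. 3.12 in particular). -/

noncomputable section

namespace Literature.AnabelianGeometry.EtaleTheta

open CategoryTheory Opposite Literature.AlgebraicGeometry.Frobenioids Literature.AnabelianGeometry.SemiGraphs
  Literature.AnabelianGeometry.SemiGraphs.GaloisObjects

universe u₀ v₀ w v v' u u'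

namespace ThetaFrobenioidTower

/-! ## The genuine connected tower: the constant-anchored capstone with the (C)-column in torsion shape -/

section Genuine

variable {K : Type u₀} [Field K] {X : SemiGraphs.TemperedArithmeticGroup.{u₀} K} {D₀ : Type u₀} [Category.{v₀} D₀]
  {V : FrdIMonoidStub.{w}} {T₀ : RealifiedDivisorMonoids (D₀ := D₀) V}
  {VD : FrdICatStub.{u₀ + 1, u₀, w} (ConnectedPart (BTemp X.Pi))}
  {tf : TemperedFrobenioid T₀ (ConnectedPart (BTemp X.Pi)) VD} {hZ : tf.monoidType = MonoidType.Z}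
  {hP : ∀ A : (ConnectedPart (BTemp X.Pi))ᵒᵖ, IsPerfect (tf.Φ.carrier A)}
  {NH : Subgroup (Field.absoluteGaloisGroup K) → tf.category → ℕ+ → Prop}
  {E : Set ℕ+} (𝒯 : ThetaEnvTower.{max u₀ w} E) (ιX : 𝒯.PiX ≃ₜ* X.Pi)
  {pullFrac : ∀ {A A' : (BiKummerSetting.mkOfConnectedTemperoidYddTower X tf hZ hP NH 𝒯 ιX).C} (_ : A' ⟶ A),
    (BiKummerSetting.mkOfConnectedTemperoidYddTower X tf hZ hP NH 𝒯 ιX).biratUnits A →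
      (BiKummerSetting.mkOfConnectedTemperoidYddTower X tf hZ hP NH 𝒯 ιX).biratUnits A'}
  {lv : ℕ+}
  {θ : (BiKummerSetting.mkOfConnectedTemperoidYddTower X tf hZ hP NH 𝒯 ιX).biratUnits
    (BiKummerSetting.mkOfConnectedTemperoidYddTower X tf hZ hP NH 𝒯 ιX).Aodot}
  {Bl : (BiKummerSetting.mkOfConnectedTemperoidYddTower X tf hZ hP NH 𝒯 ιX).C}
  {Pl : (BiKummerSetting.mkOfConnectedTemperoidYddTower X tf hZ hP NH 𝒯 ιX).FractionPair θ Bl}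
  {Rl : (BiKummerSetting.mkOfConnectedTemperoidYddTower X tf hZ hP NH 𝒯 ιX).NthRoot θ Pl lv pullFrac}
  (h : ModelFrobenioid.Hypotheses tf.divisorMonoid tf.ratFnFunctor)
  (Q : FrobenioidTheta.ThetaSubquotientStub.{w} (ConnectedPart (BTemp X.Pi))) (odd_l : Odd (lv : ℕ))
  (R : ∀ N : ℕ+, (BiKummerSetting.mkOfConnectedTemperoidYddTower X tf hZ hP NH 𝒯 ιX).NthRoot Rl.root Rl.pair N pullFrac)
  (K' : Type w) [Field K'] {X₀ : ConnectedPart (BTemp X.Pi)}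
  (hX₀ : ∀ Y : ConnectedPart (BTemp X.Pi), Subsingleton (Y ⟶ X₀)) (t : ∀ N : ℕ+, (R N).BN.base ⟶ X₀)
  (c₀ : K'ˣ →* (tf.ratFnFunctor.obj (op X₀))ˣ)
  (hinj : ∀ N : ℕ+, Function.Injective ((Units.map (tf.ratFnFunctor.map (t N).op).hom).comp c₀))
  (hinvc : ∀ (N : ℕ+) (g : Aut (R N).AN.base),
    pull tf.divisorMonoid g.hom (ModelFrobenioid.div (R N).pair.num) = ModelFrobenioid.div (R N).pair.num)
  (hinvp : ∀ (N : ℕ+) (y : 𝒯.PiX), y ∈ 𝒯.PiYdd →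
    pull tf.divisorMonoid ((BiKummerSetting.mkOfConnectedTemperoidYddTower X tf hZ hP NH 𝒯 ιX).galoisSurj (R N).AN.base
      (R N).αData.isGalois (ιX y)).hom (ModelFrobenioid.div (R N).pair.den) = ModelFrobenioid.div (R N).pair.den)
  (α : ∀ {N N' : ℕ+}, (N : ℕ) ∣ N' → ((R N').AN ⟶ (R N).AN))
  (β : ∀ {N N' : ℕ+}, (N : ℕ) ∣ N' → ((R N').BN ⟶ (R N).BN))
  (comm_sCap : ∀ {N N' : ℕ+} (hd : (N : ℕ) ∣ N'), (R N').pair.num ≫ β hd = α hd ≫ (R N).pair.num)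
  (comm_sCup : ∀ {N N' : ℕ+} (hd : (N : ℕ) ∣ N'), (R N').pair.den ≫ β hd = α hd ≫ (R N).pair.den)
  (isIsometry_α : ∀ {N N' : ℕ+} (hd : (N : ℕ) ∣ N'),
    ((BiKummerSetting.mkOfConnectedTemperoidYddTower X tf hZ hP NH 𝒯 ιX).sec5Stub h).pre.IsIsometry (α hd))
  (degFr_α : ∀ {N N' : ℕ+} (hd : (N : ℕ) ∣ N'),
    (((BiKummerSetting.mkOfConnectedTemperoidYddTower X tf hZ hP NH 𝒯 ιX).sec5Stub h).pre.degFr (α hd) : ℕ) * N = N')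
  (isIsometry_β : ∀ {N N' : ℕ+} (hd : (N : ℕ) ∣ N'),
    ((BiKummerSetting.mkOfConnectedTemperoidYddTower X tf hZ hP NH 𝒯 ιX).sec5Stub h).pre.IsIsometry (β hd))
  (degFr_β : ∀ {N N' : ℕ+} (hd : (N : ℕ) ∣ N'),
    (((BiKummerSetting.mkOfConnectedTemperoidYddTower X tf hZ hP NH 𝒯 ιX).sec5Stub h).pre.degFr (β hd) : ℕ) * N = N')
  (baseFrob_α : ∀ {N N' : ℕ+} (hd : (N : ℕ) ∣ N'),
    (BiKummerSetting.mkOfConnectedTemperoidYddTower X tf hZ hP NH 𝒯 ιX).IsOfBaseFrobeniusType (α hd))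


include hX₀ h in
/-- **[EtTh] Theorem 5.7 (root level) at ALL levels for the genuine connected tower with pulled-back constants, CONSTANT-ANCHORED form, (C)-column in TORSION shape** (twin of this seat's `…_ofConstAnchored_ofPulledConstants`, p472561, with abc-iut-w6-d049's `thetaRootPreservedAll_of_anchoredFamily_of_kummerTorsion` (p473372) as the generic closer: the binders `hgc₁` and (C) `hc` are REPLACED by {`hK`, `hgc` at every level, `S`/`hS`, `hdiff`/`hfacS` at the levels of `S`, `htorsfam`}; original docstring follows):
the anchor at the first root is PRODUCED — abc-iut-w5-d245's `exists_unit_transports_hYdd_ofConnectedTemperoidData_strv` (p437125: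
from the model hypotheses, two seed identifications `αs : Ψ(A_1) ⥲ A_1`, `βs : Ψ(B_1) ⥲ B_1` [Thm. 5.10 (i)], Prop. 5.3 (vi) at `A_1`
in `e = 1` form (`hdivcap₁`, `hdivcup₁`) and Prop. 2.4 (`hP24`, ∀γ-stability of `Π^tp_Ÿ`) ALONE: ONE base shadow `θ`, ONE unit
`e₁`, `D_c¹`, `D_p¹` with the five transport binders), then NORMALISED (`α₁ := αs ≪≫ e₁`, `β₁ := βs ≪≫ (D_c¹)⁻¹`, `u₁ := D_p¹`;
`trans_left`) — so that, compared with the capstone of record `…_ofChosen_ofPulledConstants` (p435457), the binders `ef`, `Dcf`,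
`he`, `θ₁`, `hstrv₁`, `hYdd₁` are GONE.  What remains: (A) `hnd`, `hN`, `hgc₁`, `hfac₁`, `hinj` as there; the seeds with
`hdivcap₁`/`hdivcup₁` and `hP24`; the coherent family `hfam` — for EVERY normalised anchor `(α₁, β₁, u₁)` and every `N`, identifications
`a, b` and a unit `w` with `a⁻¹ ≫ Ψ(s^⊓_N) ≫ b = s^⊓_N`, `a⁻¹ ≫ Ψ(s^⊔_N) ≫ b = s^⊔_N ≫ w`, `a⁻¹ ≫ Ψ(α_{1,N}) ≫ α₁ = α_{1,N}`,
`b⁻¹ ≫ Ψ(β_{1,N}) ≫ β₁ = β_{1,N}` (the output of abc-iut-f-121's `NthRoot.exists_unit_transport_twisted`, p438241, for the level-`N`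
root regarded as an `N`-th root of the `u₁`-twisted level-1 pair — Rmk. 4.3.2 / Prop. 4.2 (iv)); and (C) `hc` for every normalised
anchor (the level-1 discrepancy constant is a `2l`-th root of unity — Cor. 2.8 (i) on the classes of Prop. 5.2 (iii)).  The tower
is bound by the equation `hT` (instantiate with `rfl`).
[cite: MochizukiEtTh2009, Thm 5.7 p.329–330 (PDF pp.103–104); Thm 5.10 (ii) p.334 (PDF p.108); Rmk 4.3.2 p.318–319 (PDF pp.92–93); Lem 5.8 p.331 (PDF p.105)] -/
theorem thetaRootPreservedAll_ofConnectedTemperoidYddFamily_ofConstAnchored_ofKummerTorsion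
    (T : ThetaFrobenioidTower.{w} (BiKummerSetting.mkOfConnectedTemperoidYddTower X tf hZ hP NH 𝒯 ιX).C
      (ConnectedPart (BTemp X.Pi)))
    (hT : T = ofConnectedTemperoidFamily h Q odd_l R ιX K' (fun N => (Units.map (tf.ratFnFunctor.map (t N).op).hom).comp c₀)
      hinj hinvc hinvp α β comm_sCap comm_sCup isIsometry_α degFr_α isIsometry_β degFr_β baseFrob_α)
    (hnd : IsNonDilatingOn tf.divisorMonoid)
    (hN : ∃ A : (BiKummerSetting.mkOfConnectedTemperoidYddTower X tf hZ hP NH 𝒯 ιX).C,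
      ¬ (PreFrobenioidData.ofModel tf.divisorMonoid tf.ratFnFunctor tf.divBNatTrans).IsGroupLikeObj A)
    -- Lemma 5.8's geometric connectedness at EVERY level: «a unit of `B_N` commuting with `s^⊓-gp_N(Im Π^tp_Y̲)` is a constant»
    (hgc : ∀ (N : ℕ+) (u : (T.atLevel N).units (T.BN N)),
      (∀ y ∈ (T.atLevel N).imPiY, T.sgpCap N y * (u : Aut (T.BN N)) * (T.sgpCap N y)⁻¹ = u) →
        (T.atLevel N).unitsToBirat (T.BN N) u ∈ (T.constEmb N).range)
    (Ψ : (BiKummerSetting.mkOfConnectedTemperoidYddTower X tf hZ hP NH 𝒯 ιX).C ≌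
      (BiKummerSetting.mkOfConnectedTemperoidYddTower X tf hZ hP NH 𝒯 ιX).C)
    (hfac₁ : ∀ y ∈ (T.atLevel 1).imPiY, ∃ x ∈ (T.atLevel 1).HB, ∀ u ∈ (T.atLevel 1).units (T.BN 1),
      T.sgpCap 1 y * u * (T.sgpCap 1 y)⁻¹ = T.sgpCap 1 x * u * (T.sgpCap 1 x)⁻¹)
    -- the seeds of the anchor at the first root [Thm. 5.10 (i)] and the inputs of abc-iut-w5-d245's producer
    (αs : Ψ.functor.obj (T.AN 1) ≅ T.AN 1) (βs : Ψ.functor.obj (T.BN 1) ≅ T.BN 1)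
    (hdivcap₁ : T.pre.div (αs.inv ≫ Ψ.functor.map (T.sCap 1) ≫ βs.hom) = T.pre.div (T.sCap 1))
    (hdivcup₁ : T.pre.div (αs.inv ≫ Ψ.functor.map (T.sCup 1) ≫ βs.hom) = T.pre.div (T.sCup 1))
    (hP24 : ∀ γ : 𝒯.PiX ≃ₜ* 𝒯.PiX, 𝒯.PiYdd.map γ.toMulEquiv.toMonoidHom = 𝒯.PiYdd)
    -- the coherent family, for every normalised anchor WHOSE DISCREPANCY UNIT IS A GIVEN CONSTANT `c` (abc-iut-f-121's p438241 output shape)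
    (hfam : ∀ (α₁ : Ψ.functor.obj (T.AN 1) ≅ T.AN 1) (β₁ : Ψ.functor.obj (T.BN 1) ≅ T.BN 1) (u₁ : Aut (T.BN 1))
      (hu₁ : u₁ ∈ (T.atLevel 1).units (T.BN 1)),
      α₁.inv ≫ Ψ.functor.map (T.sCap 1) ≫ β₁.hom = T.sCap 1 →
      α₁.inv ≫ Ψ.functor.map (T.sCup 1) ≫ β₁.hom = T.sCup 1 ≫ u₁.hom →
      ∀ c : T.Kˣ, (T.atLevel 1).unitsToBirat (T.BN 1) ⟨u₁, hu₁⟩ = T.constEmb 1 c →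
        ∀ N : ℕ+, ∃ (a : Ψ.functor.obj (T.AN N) ≅ T.AN N) (b : Ψ.functor.obj (T.BN N) ≅ T.BN N) (w : Aut (T.BN N)),
          w ∈ (T.atLevel N).units (T.BN N) ∧
          a.inv ≫ Ψ.functor.map (T.sCap N) ≫ b.hom = T.sCap N ∧
          a.inv ≫ Ψ.functor.map (T.sCup N) ≫ b.hom = T.sCup N ≫ w.hom ∧
          a.inv ≫ Ψ.functor.map (T.α (one_dvd_level N)) ≫ α₁.hom = T.α (one_dvd_level N) ∧
          b.inv ≫ Ψ.functor.map (T.β (one_dvd_level N)) ≫ β₁.hom = T.β (one_dvd_level N))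
    -- (C) in TORSION shape (abc-iut-w6-d049, p473372): `⋂_N (K^×)^N = 1` (Prop. 3.2 (iii)), a cofinal set of levels with Prop. 4.3 (iii)
    -- and the factorisation of the Galois action on constants there, and the torsion of the Kummer cocycles of the discrepancies of
    -- EVERY family member coherent with the CONSTANT normalised anchor (Cor. 2.8 (i) on Prop. 5.2 (iii)'s classes via Thm. 5.6)
    (hK : ∀ x : T.Kˣ, (∀ N : ℕ+, ∃ d : T.Kˣ, d ^ (N : ℕ) = x) → x = 1)
    {S : Set ℕ+} (hS : ∀ n : ℕ+, ∃ M ∈ S, n ∣ M)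
    (hdiff : ∀ N ∈ S, (T.atLevel N).BiKummerDifferenceMem)
    (hfacS : ∀ N ∈ S, ∀ y ∈ (T.atLevel N).imPiY, ∃ x ∈ (T.atLevel N).HB, ∀ u ∈ (T.atLevel N).units (T.BN N),
      T.sgpCap N y * u * (T.sgpCap N y)⁻¹ = T.sgpCap N x * u * (T.sgpCap N x)⁻¹)
    (htorsfam : ∀ (α₁ : Ψ.functor.obj (T.AN 1) ≅ T.AN 1) (β₁ : Ψ.functor.obj (T.BN 1) ≅ T.BN 1) (u₁ : Aut (T.BN 1))
      (hu₁ : u₁ ∈ (T.atLevel 1).units (T.BN 1)),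
      α₁.inv ≫ Ψ.functor.map (T.sCap 1) ≫ β₁.hom = T.sCap 1 →
      α₁.inv ≫ Ψ.functor.map (T.sCup 1) ≫ β₁.hom = T.sCup 1 ≫ u₁.hom →
      ∀ c : T.Kˣ, (T.atLevel 1).unitsToBirat (T.BN 1) ⟨u₁, hu₁⟩ = T.constEmb 1 c →
      ∀ N ∈ S, ∀ (a : Ψ.functor.obj (T.AN N) ≅ T.AN N) (b : Ψ.functor.obj (T.BN N) ≅ T.BN N) (w : Aut (T.BN N)),
        w ∈ (T.atLevel N).units (T.BN N) →
        a.inv ≫ Ψ.functor.map (T.sCap N) ≫ b.hom = T.sCap N →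
        a.inv ≫ Ψ.functor.map (T.sCup N) ≫ b.hom = T.sCup N ≫ w.hom →
        a.inv ≫ Ψ.functor.map (T.α (one_dvd_level N)) ≫ α₁.hom = T.α (one_dvd_level N) →
        b.inv ≫ Ψ.functor.map (T.β (one_dvd_level N)) ≫ β₁.hom = T.β (one_dvd_level N) →
          ∃ u ∈ (T.atLevel N).muTorsion (T.BN N) N, ∀ k : (T.atLevel N).PiYdd,
            T.sgpCup N ((T.atLevel N).rhoYdd k) * w ^ (2 * T.l) * (T.sgpCup N ((T.atLevel N).rhoYdd k))⁻¹ * (w ^ (2 * T.l))⁻¹ =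
              T.sgpCup N ((T.atLevel N).rhoYdd k) * u * (T.sgpCup N ((T.atLevel N).rhoYdd k))⁻¹ * u⁻¹) :
    T.ThetaRootPreservedAll Ψ := by
  subst hT
  haveI := hX₀
  -- level-1 §5 facts (constants pulled back from `X₀`: Def. 3.6 (iii) is a theorem, abc-iut-w4-d008)
  have H₁ := ThetaFrobenioid.facts_ofConnectedTemperoidData (T := 𝒯.level ⟨1, 𝒯.one_mem⟩) h Q odd_l (R 1) ιX K'
    ((Units.map (tf.ratFnFunctor.map (t 1).op).hom).comp c₀) (hinj 1) (hinvc 1) (hinvp 1)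
    (BiKummerSetting.hH_mkOfConnectedTemperoidYddTower X tf hZ hP NH 𝒯 ιX)
    (tf.biratAutModel_unitsMap_comp_apply_of_subsingleton (R 1).BN (t 1) c₀) (hgc 1)
  -- the anchor PRODUCED at the first root (abc-iut-w5-d245, p437125)
  obtain ⟨θA, e₁, he₁, Dc₁, Dp₁, hTs, hTs', hDp₁, hstrvs, hYdds⟩ :=
    ThetaFrobenioid.exists_unit_transports_hYdd_ofConnectedTemperoidData_strv (T := 𝒯.level ⟨1, 𝒯.one_mem⟩) h Q odd_l
      (R 1) ιX K' ((Units.map (tf.ratFnFunctor.map (t 1).op).hom).comp c₀) (hinj 1) (hinvc 1) (hinvp 1)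
      QuasiTemperoid.BTempConnected.connectedPart_isOfFSMType (SemiGraphs.TemperedArithmeticGroup.isSlim_connectedPart X)
      hnd hN Ψ αs βs hdivcap₁ hdivcup₁ hP24
  -- normalisation: `α₁ := αs ≪≫ e₁`, `β₁ := βs ≪≫ (D_c¹)⁻¹`, `u₁ := D_p¹`
  have hnum : (αs ≪≫ e₁).inv ≫ Ψ.functor.map ((ofConnectedTemperoidFamily h Q odd_l R ιX K'
      (fun N => (Units.map (tf.ratFnFunctor.map (t N).op).hom).comp c₀) hinj hinvc hinvp α β comm_sCap comm_sCup
      isIsometry_α degFr_α isIsometry_β degFr_β baseFrob_α).sCap 1) ≫ (βs ≪≫ Dc₁.symm).hom =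
      (ofConnectedTemperoidFamily h Q odd_l R ιX K' (fun N => (Units.map (tf.ratFnFunctor.map (t N).op).hom).comp c₀)
        hinj hinvc hinvp α β comm_sCap comm_sCup isIsometry_α degFr_α isIsometry_β degFr_β baseFrob_α).sCap 1 := by
    -- abc-iut-w5-d245's conclusion read in the tower's currency (levels ARE `ofConnectedTemperoidData`, `rfl`)
    have hTs₂ : αs.inv ≫ Ψ.functor.map ((ofConnectedTemperoidFamily h Q odd_l R ιX K'
        (fun N => (Units.map (tf.ratFnFunctor.map (t N).op).hom).comp c₀) hinj hinvc hinvp α β comm_sCap comm_sCup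
        isIsometry_α degFr_α isIsometry_β degFr_β baseFrob_α).sCap 1) ≫ (βs ≪≫ Dc₁.symm).hom =
        e₁.hom ≫ (ofConnectedTemperoidFamily h Q odd_l R ιX K'
        (fun N => (Units.map (tf.ratFnFunctor.map (t N).op).hom).comp c₀) hinj hinvc hinvp α β comm_sCap comm_sCup
        isIsometry_α degFr_α isIsometry_β degFr_β baseFrob_α).sCap 1 ≫ (1 : Aut ((ofConnectedTemperoidFamily h Q odd_l R ιX K'
        (fun N => (Units.map (tf.ratFnFunctor.map (t N).op).hom).comp c₀) hinj hinvc hinvp α β comm_sCap comm_sCup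
        isIsometry_α degFr_α isIsometry_β degFr_β baseFrob_α).BN 1)).hom := hTs
    rw [Iso.trans_inv, Category.assoc, hTs₂]
    -- (`rw` cannot abstract the producer's witnesses at instances transparency; close by a term)
    exact (e₁.inv_hom_id_assoc _).trans (Category.comp_id _)
  have hden : (αs ≪≫ e₁).inv ≫ Ψ.functor.map ((ofConnectedTemperoidFamily h Q odd_l R ιX K'
      (fun N => (Units.map (tf.ratFnFunctor.map (t N).op).hom).comp c₀) hinj hinvc hinvp α β comm_sCap comm_sCup
      isIsometry_α degFr_α isIsometry_β degFr_β baseFrob_α).sCup 1) ≫ (βs ≪≫ Dc₁.symm).hom =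
      (ofConnectedTemperoidFamily h Q odd_l R ιX K' (fun N => (Units.map (tf.ratFnFunctor.map (t N).op).hom).comp c₀)
        hinj hinvc hinvp α β comm_sCap comm_sCup isIsometry_α degFr_α isIsometry_β degFr_β baseFrob_α).sCup 1 ≫
        Dp₁.hom := by
    have hTs₂' : αs.inv ≫ Ψ.functor.map ((ofConnectedTemperoidFamily h Q odd_l R ιX K'
        (fun N => (Units.map (tf.ratFnFunctor.map (t N).op).hom).comp c₀) hinj hinvc hinvp α β comm_sCap comm_sCup
        isIsometry_α degFr_α isIsometry_β degFr_β baseFrob_α).sCup 1) ≫ (βs ≪≫ Dc₁.symm).hom =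
        e₁.hom ≫ (ofConnectedTemperoidFamily h Q odd_l R ιX K'
        (fun N => (Units.map (tf.ratFnFunctor.map (t N).op).hom).comp c₀) hinj hinvc hinvp α β comm_sCap comm_sCup
        isIsometry_α degFr_α isIsometry_β degFr_β baseFrob_α).sCup 1 ≫ Dp₁.hom := hTs'
    rw [Iso.trans_inv, Category.assoc, hTs₂']
    exact e₁.inv_hom_id_assoc _
  -- `C` totally epimorphic and `Ψ^Aut(O^×(B_1)) = O^×(B_1)` for `β₁ := βs ≪≫ (D_c¹)⁻¹` (Thm. 4.4 (i); slimness of the base)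
  have hepi : ∀ ⦃A' B' : (BiKummerSetting.mkOfConnectedTemperoidYddTower X tf hZ hP NH 𝒯 ιX).C⦄ (f : A' ⟶ B'), Epi f :=
    ThetaFrobenioid.epi_of_model (DivB := tf.divBNatTrans) h
  obtain ⟨Ψbs, hΨbs, ⟨eΨ⟩⟩ := ThetaFrobenioid.exists_compatBase_of_model_slim
    (𝔉 := (ofConnectedTemperoidFamily h Q odd_l R ιX K' (fun N => (Units.map (tf.ratFnFunctor.map (t N).op).hom).comp c₀)
    hinj hinvc hinvp α β comm_sCap comm_sCup isIsometry_α degFr_α isIsometry_β degFr_β baseFrob_α).atLevel 1) Ψ rfl h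
    QuasiTemperoid.BTempConnected.connectedPart_isOfFSMType (SemiGraphs.TemperedArithmeticGroup.isSlim_connectedPart X)
    hnd hN
  haveI := hΨbs
  have hU₁ := ThetaFrobenioid.units_map_psiAut (𝔉 := (ofConnectedTemperoidFamily h Q odd_l R ιX K' (fun N => (Units.map (tf.ratFnFunctor.map (t N).op).hom).comp c₀)
    hinj hinvc hinvp α β comm_sCap comm_sCup isIsometry_α degFr_α isIsometry_β degFr_β baseFrob_α).atLevel 1) Ψ
    (βs ≪≫ Dc₁.symm) Ψbs eΨ
  -- the discrepancy unit `D_p¹` of the PRODUCED anchor is a constant `c ∈ K^×` (Lemma 5.8 / Thm. 5.7 rigidity at `N₁ = 1`)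
  obtain ⟨c, hcst⟩ := exists_const_of_normalisedAnchor
    (ofConnectedTemperoidFamily h Q odd_l R ιX K' (fun N => (Units.map (tf.ratFnFunctor.map (t N).op).hom).comp c₀)
      hinj hinvc hinvp α β comm_sCap comm_sCup isIsometry_α degFr_α isIsometry_β degFr_β baseFrob_α)
    Ψ hepi H₁.sgpCapSpec H₁.sgpCupSpec H₁.biKummerDifferenceMem H₁.constantsActByCyclotome hfac₁ hnum hden hDp₁ hU₁ _
    (ThetaFrobenioid.StrvTransport.trans_left _ hstrvs) hYdds
  -- the coherent family for this CONSTANT anchor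
  choose a b w hw hTf hTf' hΨα hΨβ using hfam (αs ≪≫ e₁) (βs ≪≫ Dc₁.symm) Dp₁ hDp₁ hnum hden c hcst
  refine thetaRootPreservedAll_of_anchoredFamily_of_kummerTorsion _ Ψ hepi ?_ H₁.sgpCapSpec H₁.sgpCupSpec
    H₁.biKummerDifferenceMem H₁.constantsActByCyclotome hfac₁ hK hgc hS hdiff hfacS hnum hden hDp₁ hU₁ _
    (ThetaFrobenioid.StrvTransport.trans_left _ hstrvs) hYdds a b w hw hTf hTf' hΨα hΨβ
    (fun N hN => htorsfam (αs ≪≫ e₁) (βs ≪≫ Dc₁.symm) Dp₁ hDp₁ hnum hden c hcst N hN (a N) (b N) (w N) (hw N) (hTf N)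
      (hTf' N) (hΨα N) (hΨβ N))
  delta ofConnectedTemperoidFamily
  exact hconst_ofBiKummerFamily' h _ Q odd_l R ιX
      (fun N => BiKummerSetting.mkOfConnectedTemperoid_isOpen_ker_galoisSurj X tf hZ hP NH _ _ _ (R N).AN.base
        (R N).αData.isGalois)
      _ K' (fun N => (Units.map (tf.ratFnFunctor.map (t N).op).hom).comp c₀) hinj
      (fun N => ThetaFrobenioid.hdivc_of_pull_invariant h.isDivisorial (R N) (ThetaFrobenioid.strvOfBiKummerData h (R N))
        (ThetaFrobenioid.baseMap_strvOfBiKummerData h (R N)) (hinvc N))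
      (div_strv_comp_den_connFamily h R ιX hinvp)
      α β comm_sCap comm_sCup isIsometry_α degFr_α isIsometry_β degFr_β baseFrob_α
      (fun hd => rho_comm_β_of_natural R ιX
        (BiKummerSetting.mkOfConnectedTemperoid_galoisSurj_natural X tf hZ hP NH _ _ _) α β comm_sCap hd)
      (fun N c => tf.ratFnFunctor_map_unitsMap_comp_of_subsingleton (t 1) (t N) (β (one_dvd_level N)) c₀ c)

end Genuine

end ThetaFrobenioidTower

end Literature.AnabelianGeometry.EtaleTheta

end
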